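import Summits.SmoothPoincare4.SmoothPoincare4.Theorems.CylinderEntropyCylinderRungTwoLimitHeightUnique
import Summits.SmoothPoincare4.SmoothPoincare4.Theorems.CylinderEntropyCylinderRungTwoHeightsConvergeOfUnique
import HarnessLib

/-!
# Route `CylinderEntropy`, crux `CylinderRungTwo` (stmt-SmoothPoincare4-7631), line `killing-flux`:
# THE HEIGHTS OF A THIN IMMORTAL CYLINDER FLOW CONVERGE (registered helper `helper_heightsConverge`;
# lead c4, "relaxation up to multiplicity", capstone of waves 2–3)

For a smooth mean curvature flow `IsCylinderMCF M F ν T` of closed embedded cross-sections of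
`N = S⁴ × ℝ ⊂ ℝ⁶` with typed cylinder entropy `λ_cyl(M_t) < 2` along the flow, there is a height
`c ∈ ℝ` such that `sup_x |(F t x)₅ - c| → 0` as `t → ∞`: the cross-sections converge, in the
Hausdorff sense of heights, to the single slice `S⁴ × {c}` — WITHOUT Allard's integrality theorem.

The proof is the chain landed by lead c4 (all sorry-free, all registered helpers of this line):
good times (`helper_goodTimes`), the weak limit of the area measures (`helper_limitMeasureExists`) and
its product structure (`helper_productTestLimit`, `helper_equidistribution`), the unit lower density
along the flow (`helper_unitLowerDensityAlongFlow`) moved to the good time by the shift lemma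
(`helper_shiftLemma`, `helper_cylKernelSlabBounds`, `helper_liminfDensityAlongGoodTimes`), so that
every limit height of points carries an atom of weight `≥ vol(S⁴)` of the limit measure
(`helper_kernelMassOfProduct`, `helper_verticalGaussianMassTendsto`,
`helper_kernelIntegralTendstoOfWeakLimit`, `helper_atomOfLiminfDensity`), while the total mass is
`< 2 vol(S⁴)` (`λ_cyl < 2`): two limit heights are impossible (`helper_limitHeightUnique`), and the
monotone height envelope (`helper_heightEnvelopeMonotone`) squeezes every height to the common limit
(`helper_heightsConvergeOfUnique`).

* `helper_heightsConverge` — the registered helper: `helper_heightsConvergeOfUnique` applied to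
  `helper_limitHeightUnique`.

What remains of the immortal half after this file is exactly UNIT MULTIPLICITY (`w = 1` for the
limit `w · [S⁴ × {c}]`, `w = A_∞ / vol(S⁴) ∈ [1, 2)`), i.e. the registered `stub_areaToFloor` —
today a theorem only modulo Allard (`helper_areaQuantizationOfAllard`); see
`Cruxes/CylinderRungTwo/INTEGRALITY-MEMO-c4.md`.

Everything here is PROVED (no `sorry`, no new definitions, no named facts).

References: K. Brakke, *The motion of a surface by its mean curvature* (1978), §3 (mass continuity);
R. S. Hamilton, Comm. Anal. Geom. 1 (1993) 127–137 (monotonicity in `S⁴ × ℝ`).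
-/

-- the prescribed namespace `Summit.SmoothPoincare4.SmoothPoincare4.…` repeats `SmoothPoincare4`
set_option linter.dupNamespace false

noncomputable section

open Set Filter MeasureTheory
open scoped Manifold ContDiff Topology ENNReal

namespace Summit.SmoothPoincare4.SmoothPoincare4.Cruxes.CylinderRungTwo.KillingFlux

/-- **Registered helper `helper_heightsConverge` of line `killing-flux` (lead c4): the heights of a
thin immortal cylinder flow converge uniformly to a single value.** For `IsCylinderMCF M F ν T`
with `λ_cyl(range (F t)) < 2` for all `t ≥ T` there is `c ∈ ℝ` with: for every `ε > 0` there is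
`s₀ ≥ T` such that `|(F s x)₅ - c| < ε` for all `s ≥ s₀` and all `x ∈ M`
(`helper_heightsConvergeOfUnique helper_limitHeightUnique`). [cite: Brakke1978, §3] -/
theorem helper_heightsConverge : ∀ (M : Type) [TopologicalSpace M] [T2Space M] [SecondCountableTopology M] [ChartedSpace (EuclideanSpace ℝ (Fin 4)) M] [IsManifold (𝓡 4) ∞ M] [CompactSpace M] [MeasurableSpace M] [BorelSpace M] (F : ℝ → M → EuclideanSpace ℝ (Fin 6)) (ν : ℝ → M → EuclideanSpace ℝ (Fin 6)) (T : ℝ), IsCylinderMCF M F ν T → (∀ t, T ≤ t → Literature.Geometry.Riemannian.SphericalCylinderEntropy.cylEntropy (Set.range (F t)) < 2) → ∃ c : ℝ, ∀ ε : ℝ, 0 < ε → ∃ s₀ : ℝ, T ≤ s₀ ∧ ∀ s, s₀ ≤ s → ∀ x : M, |F s x 5 - c| < ε :=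
  helper_heightsConvergeOfUnique helper_limitHeightUnique

end Summit.SmoothPoincare4.SmoothPoincare4.Cruxes.CylinderRungTwo.KillingFlux

end
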